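import Summits.ResolutionOfSingularities.ResolutionOfSingularities.Theorems.MarkedTransferCampaignW46LooseThreadValuation
import Summits.ResolutionOfSingularities.ResolutionOfSingularities.Theorems.MarkedTransferCampaignW46ThreadChainFollowedReach
import HarnessLib

/-!
# [OURS · L1 W4.6 rung (i-b)] Loose thread chains, IV: the followed-curve end game, set-up and reach (residue images,
# the dominated one-dimensional local domain `θ(R N)`, the discrete valuation ring `θ(O) = θ(R c)`)
# (cell res-hironaka, LADDER-RESOLUTION rung L, D-0089; campaign s46, prover res-L1-s46-pv-1; host route MarkedTransfer,
# `--supports stmt-ResolutionOfSingularities-16155`)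

HONEST FRAMING. Nothing here is a statement of H. Hironaka's manuscript (2017-03-23, [Hironaka2017]). Pure commutative
algebra inside a field `F` about the loose thread chains `IsLooseThreadChain b m R J` of
`MarkedTransferCampaignW46LooseThread.lean` — the ring-theoretic part of the followed-curve end game of
`MarkedTransferCampaignW46ThreadChainFollowedSetup/Reach.lean` (rung (i-a)) re-run verbatim for loose thread chains (the
transform law is not used in this file; only the valuation ring `O = ⋃ R k` of the chain, the normalization hypothesis and
the dimension of the members). The residue maps `residueMap`, residue images `residueImage`, their units, and the Krull–Akizuki
type theorem `isDiscreteValuationRing_of_subringDominates` are imported from the rung-(i-a) companions. AI review is weaker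
than expert review. No `sorry`; axioms standard.

## Contents

* `le_of_forall_le` (`O ⊆ W`), `exists_residueMap_eq` / `exists_finset_subset_range` (`θ(O) = ⋃ θ(R k)`).
* `krullDimLE_range`, `isLocalRingOf_range`, `module_finite_integralClosure_range` — `θ(R N)` is a one-dimensional
  Noetherian local domain with fraction field `κ(W)`, not a field, dominated by `θ(O)`, with finite normalization.
* `exists_reach` — `θ(O)` is a discrete valuation ring and equals `θ(R c)` for some `c ≥ N`.
* `isUnit_residueMap_iff`, `exists_ker_eq_span` (`ker θ_c = (q)`), `maximalIdeal_eq_span_of_reach` (`𝔪_c = (t, q)`).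

## References

* M. Herrmann, S. Ikeda, U. Orbanz, *Equimultiplicity and Blowing up* (1988), Thm. (30.2) (proof). [HerrmannIkedaOrbanz1988]
* O. Zariski, P. Samuel, *Commutative Algebra* II (1960), Appendix 5. [ZariskiSamuel1960]
-/

noncomputable section

set_option linter.dupNamespace false -- mandated namespace of this single-conjunct summit

open IsLocalRing

namespace Summit.ResolutionOfSingularities.ResolutionOfSingularities.Theorems

namespace CampaignW46

open Literature.AlgebraicGeometry.Resolution Literature.RingTheory.DiscreteValuationRing

universe u

variable {F : Type u} [Field F]

namespace IsLooseThreadChain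

variable {b : ℕ} {m : ℕ → ℕ} {R : ℕ → Subring F} {J : ∀ k, Ideal (R k)}

/-! ## A local subring containing the tail of the chain -/

/-- **`O ⊆ W`**: if every `R k`, `k ≥ N`, lies in the local subring `W`, so does the valuation ring `O = ⋃ R k` of the
chain. [folklore] -/
theorem le_of_forall_le (h : IsLooseThreadChain b m R J) {O : ValuationSubring F} (hO : ∀ k, SubringDominates (R k) O.toSubring) {W : LocalSubring F}
    {N : ℕ} (hall : ∀ k, N ≤ k → R k ≤ W.toSubring) : O.toSubring ≤ W.toSubring := by
  intro z hz
  obtain ⟨k, hk⟩ := (h.mem_iff_exists_mem hO z).mp hz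
  exact hall (max k N) (le_max_right _ _) (h.mono (le_max_left _ _) hk)

/-- **`θ(O) = ⋃ θ(R k)`**: every element of the residue image comes from some member `R k`, `k ≥ N`. [folklore] -/
theorem exists_residueMap_eq (h : IsLooseThreadChain b m R J) {O : ValuationSubring F} (hO : ∀ k, SubringDominates (R k) O.toSubring)
    {W : LocalSubring F} (hOW : O.toSubring ≤ W.toSubring) (N : ℕ) {c : ResidueField W.toSubring}
    (hc : c ∈ residueImage O W hOW) : ∃ k, N ≤ k ∧ ∃ z : R k, residueMap W ((hO k).1.trans hOW) z = c := by
  obtain ⟨w, rfl⟩ := hc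
  obtain ⟨k, hk⟩ := (h.mem_iff_exists_mem hO (w : F)).mp w.2
  exact ⟨max k N, le_max_right _ _, ⟨(w : F), h.mono (le_max_left _ _) hk⟩, rfl⟩

/-- A finite set of elements of `θ(O)` comes from one member `R k`, `k ≥ N`. [folklore] -/
theorem exists_finset_subset_range (h : IsLooseThreadChain b m R J) {O : ValuationSubring F} (hO : ∀ k, SubringDominates (R k) O.toSubring)
    {W : LocalSubring F} (hOW : O.toSubring ≤ W.toSubring) (N : ℕ) (T : Finset (ResidueField W.toSubring))
    (hT : ∀ c ∈ T, c ∈ residueImage O W hOW) :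
    ∃ k, N ≤ k ∧ ∀ c ∈ T, c ∈ (residueMap W ((hO k).1.trans hOW)).range := by
  classical
  choose! ι hιN hι using fun c (hc : c ∈ T) => h.exists_residueMap_eq hO hOW N (hT c hc)
  refine ⟨T.sup ι ⊔ N, le_sup_right, fun c hc => ?_⟩
  obtain ⟨z, hz⟩ := hι c hc
  have hle : R (ι c) ≤ R (T.sup ι ⊔ N) := h.mono ((Finset.le_sup hc).trans le_sup_left)
  exact ⟨Subring.inclusion hle z, hz⟩

end IsLooseThreadChain

namespace IsLooseThreadChain

variable {b : ℕ} {m : ℕ → ℕ} {R : ℕ → Subring F} {J : ∀ k, Ideal (R k)}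

section Followed

variable {O : ValuationSubring F} (hO : ∀ k, SubringDominates (R k) O.toSubring) {W : LocalSubring F} {N : ℕ}
  (hall : ∀ k, N ≤ k → R k ≤ W.toSubring)
include hO hall

omit hO in
/-- The kernel of `θ_N : R N → κ(W)` is a non-zero prime of dimension-one quotient, as soon as `W` misses the inverse
of a non-zero `w ∈ R N`: so `θ(R N)` is a Noetherian local ring of dimension `≤ 1`. [folklore] -/
theorem krullDimLE_range (h : IsLooseThreadChain b m R J) (hnon : ∃ w : R N, w ≠ 0 ∧ (w : F)⁻¹ ∉ W.toSubring) :
    IsNoetherianRing (residueMap W (hall N le_rfl)).range ∧ IsLocalRing (residueMap W (hall N le_rfl)).range ∧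
      Ring.KrullDimLE 1 (residueMap W (hall N le_rfl)).range ∧ RingHom.ker (residueMap W (hall N le_rfl)) ≠ ⊥ := by
  haveI := h.isRegularLocalRing N
  set θ := residueMap W (hall N le_rfl) with hθ
  haveI hloc : IsLocalRing θ.range := IsLocalRing.of_surjective' θ.rangeRestrict θ.rangeRestrict_surjective
  obtain ⟨w, hw0, hwinv⟩ := hnon
  have hwker : w ∈ RingHom.ker θ := by
    rw [RingHom.mem_ker, hθ, residueMap_eq_zero_iff, mem_maximalIdeal_iff_inv_not_mem]; exact Or.inr hwinv
  refine ⟨isNoetherianRing_range θ, hloc, ?_, fun hbot => hw0 (by rw [hbot, Ideal.mem_bot] at hwker; exact hwker)⟩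
  rw [Ring.krullDimLE_iff]
  have h1 := ringKrullDim_quotient_succ_le_of_nonZeroDivisor (mem_nonZeroDivisors_of_ne_zero hw0)
  rw [h.ringKrullDim_eq_two N] at h1
  have hsurj : Function.Surjective (Ideal.Quotient.factor ((Ideal.span_singleton_le_iff_mem _).mpr hwker)) :=
    Ideal.Quotient.factor_surjective _
  have h2 := ringKrullDim_le_of_surjective _ hsurj
  rw [Nat.cast_one, ← ringKrullDim_eq_of_ringEquiv (RingHom.quotientKerEquivRange θ)]
  refine h2.trans ?_
  generalize hd : ringKrullDim (R N ⧸ Ideal.span {w}) = d at h1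
  induction d using WithBot.recBotCoe with
  | bot => exact bot_le
  | coe e =>
    have h1' : ((e + 1 : ℕ∞) : WithBot ℕ∞) ≤ ((2 : ℕ∞) : WithBot ℕ∞) := h1
    have h1'' : e + 1 ≤ 1 + 1 := WithBot.coe_le_coe.mp h1'
    exact WithBot.coe_le_coe.mpr ((ENat.add_le_add_iff_right ENat.one_ne_top).mp h1'')

/-- `θ(R N)` has fraction field `κ(W)`, is not a field, and is dominated by `θ(O)`. [folklore] -/
theorem isLocalRingOf_range (h : IsLooseThreadChain b m R J)
    (hfrac : ∀ w ∈ W.toSubring, ∃ a ∈ R N, ∃ s ∈ R N, s ≠ 0 ∧ s⁻¹ ∈ W.toSubring ∧ w = a * s⁻¹)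
    (hunit : ∃ z : R N, z ≠ 0 ∧ (z : F)⁻¹ ∉ R N ∧ (z : F)⁻¹ ∈ W.toSubring)
    (hnon : ∃ w : R N, w ≠ 0 ∧ (w : F)⁻¹ ∉ W.toSubring) :
    IsLocalRingOf (residueMap W (hall N le_rfl)).range ∧ ¬ IsField (residueMap W (hall N le_rfl)).range ∧
      SubringDominates (residueMap W (hall N le_rfl)).range
        (residueImage O W (h.le_of_forall_le hO hall)).toSubring := by
  haveI := h.isRegularLocalRing N
  obtain ⟨-, hloc, -, -⟩ := h.krullDimLE_range hall hnon
  set θ := residueMap W (hall N le_rfl) with hθ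
  have hOW := h.le_of_forall_le hO hall
  haveI := hloc
  have hθne : ∀ s : R N, s ≠ 0 → (s : F)⁻¹ ∈ W.toSubring → θ s ≠ 0 := fun s hs0 hsinv =>
    (residueMap_ne_zero_iff W (hall N le_rfl) (z := s) (fun e => hs0 (Subtype.ext e))).mpr hsinv
  have hdom : SubringDominates θ.range (residueImage O W hOW).toSubring := by
    refine ⟨?_, fun x hx hxinv => ?_⟩
    · rintro _ ⟨z, rfl⟩; exact IsThreadChain.residueMap_mem_residueImage hO hOW N z
    · obtain ⟨z, rfl⟩ := hx
      by_cases hz : θ z = 0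
      · rw [hz, inv_zero]; exact θ.range.zero_mem
      have hzinv : (z : F)⁻¹ ∈ R N := (inv_mem_residueImage_iff hOW (hO N) z hz).mp hxinv
      have hz0 : (z : F) ≠ 0 := fun e => hz (by rw [show z = 0 from Subtype.ext e, map_zero])
      refine ⟨⟨(z : F)⁻¹, hzinv⟩, ?_⟩
      have hmul : θ z * θ ⟨(z : F)⁻¹, hzinv⟩ = 1 := by
        rw [← map_mul, ← map_one θ]; congr 1; exact Subtype.ext (mul_inv_cancel₀ hz0)
      exact (inv_eq_of_mul_eq_one_right hmul).symm
  refine ⟨⟨hloc, fun c => ?_⟩, fun hfield => ?_, hdom⟩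
  · obtain ⟨w, rfl⟩ := residue_surjective (R := W.toSubring) c
    obtain ⟨a, ha, s, hs, hs0, hsinv, hw⟩ := hfrac w w.2
    have hs0' : (⟨s, hs⟩ : R N) ≠ 0 := fun e => hs0 (congrArg Subtype.val e)
    refine ⟨θ ⟨a, ha⟩, ⟨_, rfl⟩, θ ⟨s, hs⟩, ⟨_, rfl⟩, hθne _ hs0' hsinv, ?_⟩
    have hws : w * ⟨s, hall N le_rfl hs⟩ = ⟨a, hall N le_rfl ha⟩ := by
      apply Subtype.ext
      change (w : F) * s = a
      rw [hw, mul_assoc, inv_mul_cancel₀ hs0, mul_one]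
    have e := congrArg (residue W.toSubring) hws
    rw [map_mul] at e
    rw [eq_div_iff (hθne _ hs0' hsinv)]
    exact e
  · -- `θ(z)` is a non-zero non-unit
    obtain ⟨z, hz0, hzninv, hzinv⟩ := hunit
    have hθz : θ z ≠ 0 := hθne z hz0 hzinv
    obtain ⟨y, hy⟩ := hfield.mul_inv_cancel (a := ⟨θ z, ⟨z, rfl⟩⟩) (fun e => hθz (congrArg Subtype.val e))
    apply hzninv
    apply (inv_mem_residueImage_iff hOW (hO N) z hθz).mp
    have : (θ z)⁻¹ = (y : ResidueField W.toSubring) := by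
      have e := congrArg Subtype.val hy
      exact inv_eq_of_mul_eq_one_right e
    rw [this]
    exact hdom.1 y.2

/-- `θ(R N)` has module-finite normalization (from the thread chain's normalization hypothesis at `R N`). [folklore] -/
theorem module_finite_integralClosure_range (h : IsLooseThreadChain b m R J)
    (hfrac : ∀ w ∈ W.toSubring, ∃ a ∈ R N, ∃ s ∈ R N, s ≠ 0 ∧ s⁻¹ ∈ W.toSubring ∧ w = a * s⁻¹)
    (hunit : ∃ z : R N, z ≠ 0 ∧ (z : F)⁻¹ ∉ R N ∧ (z : F)⁻¹ ∈ W.toSubring)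
    (hnon : ∃ w : R N, w ≠ 0 ∧ (w : F)⁻¹ ∉ W.toSubring) :
    Module.Finite (residueMap W (hall N le_rfl)).range
      (integralClosure (residueMap W (hall N le_rfl)).range (ResidueField W.toSubring)) := by
  haveI := h.isRegularLocalRing N
  set θ := residueMap W (hall N le_rfl) with hθ
  obtain ⟨hofA, -, -⟩ := h.isLocalRingOf_range hO hall hfrac hunit hnon
  haveI hkerp : (RingHom.ker θ).IsPrime := RingHom.ker_isPrime θ
  haveI := h.finite_integralClosure N (RingHom.ker θ) hkerp
  haveI : IsFractionRing θ.range (ResidueField W.toSubring) := isFractionRing_of_isLocalRingOf_le hofA.2 le_rfl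
  exact module_finite_integralClosure_of_ringEquiv (RingHom.quotientKerEquivRange θ)
    (FractionRing (R N ⧸ RingHom.ker θ)) (ResidueField W.toSubring)

/-- **Reach.** Under the hypotheses above, the residue image `θ(O)` is a discrete valuation ring and is already the
image `θ(R c)` of one member of the chain (the normalization of `θ(R N)` is finite, its generators lie in some
`θ(R c)`, and `θ(O)` is its localization at the centre, whose denominators are units of `θ(R c)` by domination).
[cite: HerrmannIkedaOrbanz1988, Thm. (30.2) (proof)] -/
theorem exists_reach (h : IsLooseThreadChain b m R J)
    (hfrac : ∀ w ∈ W.toSubring, ∃ a ∈ R N, ∃ s ∈ R N, s ≠ 0 ∧ s⁻¹ ∈ W.toSubring ∧ w = a * s⁻¹)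
    (hunit : ∃ z : R N, z ≠ 0 ∧ (z : F)⁻¹ ∉ R N ∧ (z : F)⁻¹ ∈ W.toSubring)
    (hnon : ∃ w : R N, w ≠ 0 ∧ (w : F)⁻¹ ∉ W.toSubring) :
    IsDiscreteValuationRing (residueImage O W (h.le_of_forall_le hO hall)) ∧
      ∃ (c : ℕ) (hc : N ≤ c), ∀ v ∈ residueImage O W (h.le_of_forall_le hO hall),
        v ∈ (residueMap W (hall c hc)).range := by
  have hOW := h.le_of_forall_le hO hall
  obtain ⟨hnoeth, hloc, hdim, -⟩ := h.krullDimLE_range hall hnon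
  obtain ⟨hofA, hnf, hdom⟩ := h.isLocalRingOf_range hO hall hfrac hunit hnon
  have hfin := h.module_finite_integralClosure_range hO hall hfrac hunit hnon
  haveI := hnoeth
  haveI := hdim
  obtain ⟨hdvr, N', S, hN'V, hSN', hN'S, hVN'⟩ :=
    isDiscreteValuationRing_of_subringDominates hofA hnf hfin (residueImage O W hOW) hdom
  refine ⟨hdvr, ?_⟩
  obtain ⟨c, hNc, hSc⟩ := h.exists_finset_subset_range hO hOW N S (fun x hx => hN'V (hSN' (Finset.mem_coe.mpr hx)))
  refine ⟨c, hNc, fun v hv => ?_⟩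
  -- `N' ⊆ θ(R c)`
  have hAc : (residueMap W (hall N le_rfl)).range ≤ (residueMap W (hall c hNc)).range := by
    rintro _ ⟨z, rfl⟩; exact ⟨Subring.inclusion (h.mono hNc) z, rfl⟩
  have hN'c : N' ≤ (residueMap W (hall c hNc)).range :=
    hN'S.trans (Subring.closure_le.mpr (Set.union_subset hAc fun x hx => hSc x (Finset.mem_coe.mp hx)))
  -- `v = y / z` with `y, z ∈ N'`, `z` a unit of `θ(O)`, hence of `θ(R c)`
  obtain ⟨y, hy, z, hz, hvz, rfl⟩ := hVN' hv
  obtain ⟨ζ, hζ⟩ := hN'c hz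
  have hz0 : z ≠ 0 := ne_zero_of_valuation_eq_one hvz
  have hzinv : z⁻¹ ∈ residueImage O W hOW := by
    rw [← (residueImage O W hOW).valuation_le_one_iff, map_inv₀, hvz, inv_one]
  have hθζ : residueMap W ((hO c).1.trans hOW) ζ ≠ 0 := by rw [show residueMap W ((hO c).1.trans hOW) ζ = z from hζ]; exact hz0
  have hζinv : (ζ : F)⁻¹ ∈ R c := (inv_mem_residueImage_iff hOW (hO c) ζ hθζ).mp (by
    rw [show residueMap W ((hO c).1.trans hOW) ζ = z from hζ]; exact hzinv)
  have hzinv' : z⁻¹ ∈ (residueMap W (hall c hNc)).range := by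
    refine ⟨⟨(ζ : F)⁻¹, hζinv⟩, ?_⟩
    have hζ0 : (ζ : F) ≠ 0 := fun e => hθζ (by rw [show ζ = 0 from Subtype.ext e, map_zero])
    have hmul : residueMap W (hall c hNc) ζ * residueMap W (hall c hNc) ⟨(ζ : F)⁻¹, hζinv⟩ = 1 := by
      rw [← map_mul, ← map_one (residueMap W (hall c hNc))]; congr 1; exact Subtype.ext (mul_inv_cancel₀ hζ0)
    rw [← hζ]
    exact (inv_eq_of_mul_eq_one_right hmul).symm
  rw [div_eq_mul_inv]
  exact Subring.mul_mem _ (hN'c hy) hzinv'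

end Followed

end IsLooseThreadChain

namespace IsLooseThreadChain

variable {b : ℕ} {m : ℕ → ℕ} {R : ℕ → Subring F} {J : ∀ k, Ideal (R k)}

section Descent

variable {O : ValuationSubring F} (hO : ∀ k, SubringDominates (R k) O.toSubring) {W : LocalSubring F} {N : ℕ}
  (hall : ∀ k, N ≤ k → R k ≤ W.toSubring)
include hO hall

/-- `θ_k(z)` is a unit of `θ(O)` iff `z` is a unit of `R k`. [folklore] -/
theorem isUnit_residueMap_iff (h : IsLooseThreadChain b m R J) {k : ℕ} (hk : N ≤ k) (z : R k) :
    IsUnit (⟨residueMap W (hall k hk) z, IsThreadChain.residueMap_mem_residueImage hO (h.le_of_forall_le hO hall) k z⟩ :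
      residueImage O W (h.le_of_forall_le hO hall)) ↔ IsUnit z := by
  have hOW := h.le_of_forall_le hO hall
  rw [isUnit_residueImage_iff, isUnit_subring_iff_inv_mem]
  constructor
  · rintro ⟨h0, hinv⟩
    have hz0 : (z : F) ≠ 0 := fun e => h0 (by
      change residueMap W (hall k hk) z = 0; rw [show z = 0 from Subtype.ext e, map_zero])
    exact ⟨hz0, (inv_mem_residueImage_iff hOW (hO k) z h0).mp hinv⟩
  · rintro ⟨hz0, hinv⟩
    have h0 : residueMap W (hall k hk) z ≠ 0 := by
      rw [residueMap_ne_zero_iff W (hall k hk) hz0]; exact hOW ((hO k).1 hinv)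
    exact ⟨h0, (inv_mem_residueImage_iff hOW (hO k) z h0).mpr hinv⟩

omit hO in
/-- The kernel of `θ_c` is `(q)` for a prime element `q` of `R c`, as soon as some NON-UNIT `t` of `R c` has non-zero
residue and `W` misses the inverse of a non-zero element of `R N`. [folklore] -/
theorem exists_ker_eq_span (h : IsLooseThreadChain b m R J) {c : ℕ} (hc : N ≤ c) (hnon : ∃ w : R N, w ≠ 0 ∧ (w : F)⁻¹ ∉ W.toSubring) {t : R c}
    (htnu : ¬ IsUnit t) (hθt0 : residueMap W (hall c hc) t ≠ 0) :
    ∃ q : R c, Prime q ∧ RingHom.ker (residueMap W (hall c hc)) = Ideal.span {q} := by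
  haveI := h.isRegularLocalRing c
  have hdim := h.ringKrullDim_eq_two c
  haveI hkerp : (RingHom.ker (residueMap W (hall c hc))).IsPrime := RingHom.ker_isPrime _
  have hkerm : RingHom.ker (residueMap W (hall c hc)) ≠ maximalIdeal (R c) := by
    intro he
    have : t ∈ RingHom.ker (residueMap W (hall c hc)) := by rw [he, mem_maximalIdeal, mem_nonunits_iff]; exact htnu
    exact hθt0 this
  obtain ⟨q, hq⟩ := exists_eq_span_singleton_of_ne_maximalIdeal hdim _ hkerm
  have hq0 : q ≠ 0 := by
    obtain ⟨w, hw0, hwinv⟩ := hnon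
    rintro rfl
    have hw : Subring.inclusion (h.mono hc) w ∈ RingHom.ker (residueMap W (hall c hc)) := by
      rw [RingHom.mem_ker, residueMap_eq_zero_iff, mem_maximalIdeal_iff_inv_not_mem]; exact Or.inr hwinv
    rw [hq, Ideal.span_singleton_eq_bot.mpr rfl, Ideal.mem_bot] at hw
    exact hw0 (Subring.inclusion_injective _ (by rw [hw, map_zero]))
  have hqp' : (Ideal.span {q}).IsPrime := by rw [← hq]; exact hkerp
  exact ⟨q, (Ideal.span_singleton_prime hq0).mp hqp', hq⟩

/-- In the reached regime (`θ(R c) = θ(O)`, a discrete valuation ring with uniformizer `θ(t)`, `t ∈ R c`), with the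
kernel of `θ_c` equal to `(q)`: `𝔪_c = (t, q)`. [cite: HerrmannIkedaOrbanz1988, Thm. (30.2) (proof)] -/
theorem maximalIdeal_eq_span_of_reach (h : IsLooseThreadChain b m R J) {c : ℕ} (hc : N ≤ c)
    [IsDiscreteValuationRing (residueImage O W (h.le_of_forall_le hO hall))]
    (hreach : ∀ v ∈ residueImage O W (h.le_of_forall_le hO hall), ∃ z : R c, residueMap W (hall c hc) z = v)
    {t q : R c} (hqp : Prime q) (hq : RingHom.ker (residueMap W (hall c hc)) = Ideal.span {q})
    (hϖ : Irreducible (⟨residueMap W (hall c hc) t, IsThreadChain.residueMap_mem_residueImage hO (h.le_of_forall_le hO hall) c t⟩ :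
      residueImage O W (h.le_of_forall_le hO hall))) :
    (haveI := (h.isRegularLocalRing c).toIsLocalRing; maximalIdeal (R c)) = Ideal.span {t, q} := by
  classical
  have hOW := h.le_of_forall_le hO hall
  haveI := h.isRegularLocalRing c
  have hunit_iff := h.isUnit_residueMap_iff hO hall hc
  have htnu : ¬ IsUnit t := fun hu => hϖ.not_isUnit ((hunit_iff t).mpr hu)
  have hqt : Ideal.span {q} ≤ Ideal.span {t, q} :=
    Ideal.span_mono (Set.singleton_subset_iff.mpr (Set.mem_insert_of_mem _ (Set.mem_singleton q)))
  refine le_antisymm ?_ ?_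
  · intro z hz
    by_cases hθz : residueMap W (hall c hc) z = 0
    · have : z ∈ Ideal.span {q} := by rw [← hq, RingHom.mem_ker]; exact hθz
      exact hqt this
    · have hzu : ¬ IsUnit z := by rw [mem_maximalIdeal, mem_nonunits_iff] at hz; exact hz
      have hmemm : (⟨residueMap W (hall c hc) z, IsThreadChain.residueMap_mem_residueImage hO hOW _ z⟩ : residueImage O W hOW) ∈
          maximalIdeal (residueImage O W hOW) := by
        rw [mem_maximalIdeal, mem_nonunits_iff, hunit_iff]; exact hzu
      rw [(IsDiscreteValuationRing.irreducible_iff_uniformizer _).mp hϖ, Ideal.mem_span_singleton'] at hmemm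
      obtain ⟨v, hv⟩ := hmemm
      obtain ⟨a, ha⟩ := hreach v v.2
      have hker : z - a * t ∈ RingHom.ker (residueMap W (hall c hc)) := by
        rw [RingHom.mem_ker, map_sub, map_mul, ha, sub_eq_zero]
        have := congrArg Subtype.val hv
        exact this.symm
      rw [hq] at hker
      have e : z = a * t + (z - a * t) := by ring
      rw [e]
      exact Ideal.add_mem _ (Ideal.mul_mem_left _ _ (Ideal.subset_span (Set.mem_insert _ _))) (hqt hker)
  · rw [Ideal.span_le]
    intro z hz
    rcases hz with hz | hz
    · rw [hz, SetLike.mem_coe, mem_maximalIdeal, mem_nonunits_iff]; exact htnu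
    · rw [Set.mem_singleton_iff] at hz
      rw [hz, SetLike.mem_coe, mem_maximalIdeal, mem_nonunits_iff]; exact hqp.not_unit


end Descent

end IsLooseThreadChain

end CampaignW46

end Summit.ResolutionOfSingularities.ResolutionOfSingularities.Theorems

end
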